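import Mathlib
import HarnessLib
import Summits.SmoothPoincare4.SmoothPoincare4.Theses.SmoothBijectionDefect

/-!
# Line `engulf` — DEFECT ENGULFING normal form of the crux `ShRigid` (stmt-SmoothPoincare4-13496)

Route `SmoothBijectionDefect` (route-SmoothPoincare4-SmoothBijectionDefect), crux #3 `ShRigid`:

  `∀ Σ : HomotopySphere 4, (∃ smooth bijection f : S⁴ → Σ) ∨ (∃ smooth bijection g : Σ → S⁴) →
     ∀ p, Σ ∖ {p} embeds smoothly in ℝ⁴`.

Strategist line (crux-strategist seat `planner-cstrat-stmt-SmoothPoincare4-13496-s1-0`, 2026-08-17),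
registered ALONGSIDE the birth skeleton `Lines/birth.lean` (stubs R, H, F, T), never replacing it.

## The observation

Let `g : Σ → S⁴` be a smooth bijection and `D ⊆ Σ` its DEFECT `{y | g is not a local diffeomorphism at y}`
(closed, hence compact; nowhere dense). Off `D`, `g` is an injective local diffeomorphism, i.e. an open
smooth embedding `Σ ∖ D ↪ S⁴`. Dually, for a smooth bijection `f : S⁴ → Σ` with defect `D ⊆ S⁴`, the
inverse `f⁻¹` is smooth on the open set `Σ ∖ f(D)` and embeds it in `S⁴`. In both cases

  **the complement of the Σ-side defect set already embeds smoothly in `S⁴`, by the comparison map itself.**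

Hence, if the Σ-side defect set lies inside a smooth 4-ball `B ⊆ Σ` (equivalently: inside the range of an
open smooth embedding `φ : ℝ⁴ → Σ`), then `Σ ∖ B ⊆ Σ ∖ (defect)` embeds in `S⁴` minus a point `≅ ℝ⁴`, and
`Σ ∖ B ≅ Σ ∖ {φ 0}` by a radial push inside the chart (identity off the chart). So `Σ ∖ {φ 0} ↪ ℝ⁴`, and
homogeneity moves the puncture to any `p`. Conversely, if `Σ` is a unit then `Σ ∖ {q} ≅ ℝ⁴` for `q ∉ D`
(Mazur swindle, Gabai arXiv:2212.02004 Prop. 1.9; `D ≠ Σ` by Sard), so the defect IS engulfed by a chart.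
Therefore, given the true plumbing stubs,

  **ShRigid ⟺ (the Σ-side defect of every smooth bijection `S⁴ ⇄ Σ` is engulfed by a chart domain of Σ)**,

and EVERY proof of the crux can be put in this normal form (the embedding `Σ ∖ {p} ↪ ℝ⁴` may always be taken
to be `stereo ∘ g ∘ push`, resp. `stereo ∘ f⁻¹ ∘ push`). The open content of the crux is thus a statement
about the POSITION OF A COMPACT NOWHERE-DENSE SET `D` in `Σ` — an ENGULFING problem — and nothing else.

## Stubs (5; sorries only here)

* `stub_engulfFrom` (E_F, OPEN, apex — source side): smooth bijection `f : S⁴ → M` onto a closed smooth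
  4-manifold ⟹ the defect IMAGE `f {x | ¬ local diffeo at x}` lies in the range of an injective local
  diffeomorphism `φ : ℝ⁴ → M`.
* `stub_engulfTo` (E_T, OPEN, apex — target side): smooth bijection `g : M → S⁴` ⟹ the defect
  `{y | ¬ local diffeo at y}` lies in the range of such a `φ`.
* `stub_pushOffFrom` (P_F, TRUE, M–L): in the situation of E_F with `φ` given, `M ∖ {φ 0} ↪ ℝ⁴`
  (compactness: `f(D) ⊆ φ(B̄(0,r))`; radial push `M ∖ {φ 0} ≅ M ∖ φ(B̄(0,r))`; `f⁻¹` is a smooth open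
  embedding on `M ∖ f(D) ⊇ M ∖ φ(B̄(0,r))`; stereographic chart from `f⁻¹ (φ 0)`).
* `stub_pushOffTo` (P_T, TRUE, M–L): the same with `g` in place of `f⁻¹`.
* `stub_homogeneity` (H, TRUE, M–L): VERBATIM the birth line's stub H (one proof closes both lines).

Composition `shRigid_of_stubSigs : H → P_F → P_T → E_F → E_T → (body of ShRigid)` and
`ShRigid_of : ShRigid` are SORRY-FREE; `sorry` occurs only in the five `stub_*` bodies.

## Why this cut (relative to `birth`)

`birth` isolates the open cores as F/T = "`N ∖ {pt} ↪ ℝ⁴`", an existence statement about an embedding of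
a whole open 4-manifold, for which no tool offers a handle. `engulf` shows the embedding is never the
issue: it is forced to be the comparison map itself, and the ENTIRE open content is "the defect sits in a
ball of the fake side". What this exposes: (i) the defect-dimension ladder becomes operational — finite
defects, and defects inside a smoothly embedded finite graph, engulf at once (general position in a simply
connected 4-manifold), extending the route's calibrated one-point rung `UnitOfOnePointDefect` with no
flatness analysis; (ii) the enemy is named: a fake non-unit Σ comparable with `S⁴` must carry its defect on
a non-engulfable compactum — in the presence of a 2-spine `L` of the fake ball `Q = N(L)`, `Σ ∖ L ≅ ℝ⁴`
embeds in `S⁴`, so (β) is exactly the assertion that no smooth bijection realises such a collapse; (iii)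
the lever that then applies is engulfing / cellularity theory (tree: `RadialEngulfing`, `CellularSets`,
`CellEngulfingFromEngulfing`, `TwoSidedEngulfing`), not 4-manifold embedding theory.
E_F ⟺ F and E_T ⟺ T in truth value (given P, H, Sard and the swindle): the line is an exact reformulation,
neither stronger nor weaker than the crux's two halves; it is refutable only by a comparable non-unit fake
4-sphere (the crux's own risk).

Why the apex keeps the bijection (cheapest falsifier of over-generalisation): "an open `W ⊆ M` embedding in
`S⁴` with nowhere-dense complement has chart-engulfable complement" is FALSE for `M = ℂP²`, `W = ⊔` open top
simplices of a triangulation (complement engulfed ⇒ `M = B⁴ ∪ W'`, `W' ⊂ ℝ⁴` ⇒ `H₂ M = 0`), and on homotopy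
spheres the same example makes it equivalent to (A) "every Σ is a unit" — it forgets comparability; the
bijectivity of `g` across `D` (the embedding of `Σ ∖ D` extends to a homeomorphism `Σ → S⁴`) is what E_T
retains and what any proof must use.

## Disproof used

None exists (`ledger crux ls stmt-SmoothPoincare4-13496`: Lines/birth.* only; no Disproof.lean, no Negative/
lemma; `ledger negatives --problem SmoothPoincare4` = 0, 2026-08-17). Refuter crux-attack restatements
(`SchsplitPuncturedEmbeds → ShRigid`, `ThinDefect → ShRigid → SchsplitPuncturedEmbeds`): no stub is an
instance of either (E/P are statements about one comparison map and its defect).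

## References

* D. Gabai, *3-spheres in the 4-sphere and pseudo-isotopies of S¹ × S³*, arXiv:2212.02004, Def. 1.3, Prop. 1.9.
* B. Mazur, *A note on some contractible 4-manifolds*, Ann. of Math. 73 (1961) (infinite-sum swindle).
* J. Milnor, *Topology from the Differentiable Viewpoint* (1965), §4 Homogeneity Lemma; §§2–3 Sard.
* R. Palais, *Extending diffeomorphisms*, Proc. AMS 11 (1960) (disc theorem; `Σ ∖ ball ≅ Σ ∖ pt`).
* M. W. Hirsch, *Differential Topology* (1976), Ch. 8 §3 Thm. 3.1 (tree `Homogeneity.lean`).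
* M. Shiota, M. Yokoi, Trans. AMS 286 (1984) 727–750; M. Shiota, Invent. Math. 196 (2014) 163–232
  (o-minimal Hauptvermutung: TAME comparisons force `Σ ≅ S⁴` — the defect of a comparison on a fake Σ is
  necessarily non-tame; census `STRATEGY-CENSUS.md` §Transfer).
-/

set_option linter.dupNamespace false
set_option linter.unusedVariables false

noncomputable section

namespace Summit.SmoothPoincare4.SmoothPoincare4.Cruxes.ShRigid.Engulf

open scoped Manifold ContDiff Topology
open Literature.Topology.FourManifolds
open Summit.SmoothPoincare4.SmoothPoincare4.Theses.SmoothBijectionDefect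

/-- Local notation: the model space `ℝ⁴ = EuclideanSpace ℝ (Fin 4)`. -/
local notation "ℝ⁴" => EuclideanSpace ℝ (Fin 4)

/-- Local notation: the round 4-sphere `S⁴ ⊂ ℝ⁵` with Mathlib's stereographic atlas. -/
local notation "𝕊⁴" => (Metric.sphere (0 : EuclideanSpace ℝ (Fin 5)) 1)

/-! ## The stubs -/

/-- **Stub E_F `stub_engulfFrom` — THE OPEN CORE, source side, in engulfing form.** If `f : S⁴ → M` is a
smooth bijection onto a closed smooth 4-manifold `M`, then the IMAGE of its defect set
`{x | f is not a C^∞ local diffeomorphism at x}` lies in the range of an injective local diffeomorphism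
`φ : ℝ⁴ → M` (an open smooth 4-cell of `M`). OPEN: equivalent (given P_F, H, Sard, Mazur's swindle) to the
`S⁴ → Σ` half of the crux; false iff some non-unit homotopy 4-sphere receives a smooth bijection from `S⁴`.
Why it might hold: the defect image is a compact null nowhere-dense set and `M ∖ f(D) ≅ S⁴ ∖ D`; finite or
graph-supported defect images engulf by general position. Why it might fail: a 2-spine of a fake ball.
OPEN route obligation, not a cited result; sources: arXiv:2212.02004 (Prop. 1.9), MilnorTDV1965 §4. -/
theorem stub_engulfFrom :
    ∀ (M : Type) [TopologicalSpace M] [T2Space M] [SecondCountableTopology M]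
      [ChartedSpace ℝ⁴ M] [IsManifold (𝓡 4) ∞ M] [CompactSpace M]
      (f : 𝕊⁴ → M), ContMDiff (𝓡 4) (𝓡 4) ∞ f → Function.Bijective f →
        ∃ φ : ℝ⁴ → M, ContMDiff (𝓡 4) (𝓡 4) ∞ φ ∧ Function.Injective φ ∧
          IsLocalDiffeomorph (𝓡 4) (𝓡 4) ∞ φ ∧
          ∀ x : 𝕊⁴, ¬ IsLocalDiffeomorphAt (𝓡 4) (𝓡 4) ∞ f x → f x ∈ Set.range φ := by
  sorry

/-- **Stub E_T `stub_engulfTo` — THE OPEN CORE, target side, in engulfing form.** If `g : M → S⁴` is a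
smooth bijection from a closed smooth 4-manifold `M`, then its defect set
`{y | g is not a C^∞ local diffeomorphism at y}` lies in the range of an injective local diffeomorphism
`φ : ℝ⁴ → M`. OPEN: equivalent (given P_T, H, Sard, Mazur's swindle) to the `Σ → S⁴` half of the crux;
false iff some non-unit homotopy 4-sphere maps smoothly and bijectively onto `S⁴`. Why it might hold:
`M ∖ D ≅ S⁴ ∖ g(D)` along `g`, `D` compact nowhere dense; engulfable whenever `D` is finite or lies in a
smoothly embedded finite graph. Why it might fail: a smooth bijection collapsing exactly a 2-spine of a
fake ball. OPEN route obligation, not a cited result; sources: arXiv:2212.02004 (Prop. 1.9), MilnorTDV1965 §4. -/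
theorem stub_engulfTo :
    ∀ (M : Type) [TopologicalSpace M] [T2Space M] [SecondCountableTopology M]
      [ChartedSpace ℝ⁴ M] [IsManifold (𝓡 4) ∞ M] [CompactSpace M]
      (g : M → 𝕊⁴), ContMDiff (𝓡 4) (𝓡 4) ∞ g → Function.Bijective g →
        ∃ φ : ℝ⁴ → M, ContMDiff (𝓡 4) (𝓡 4) ∞ φ ∧ Function.Injective φ ∧
          IsLocalDiffeomorph (𝓡 4) (𝓡 4) ∞ φ ∧
          ∀ y : M, ¬ IsLocalDiffeomorphAt (𝓡 4) (𝓡 4) ∞ g y → y ∈ Set.range φ := by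
  sorry

/-- **Stub P_F `stub_pushOffFrom` — engulfed defect image ⟹ punctured embedding (source side).** Let
`f : S⁴ → M` be a smooth bijection onto a closed smooth 4-manifold and `φ : ℝ⁴ → M` an injective local
diffeomorphism whose range contains `f x` for every non-regular point `x` of `f`. Then `M ∖ {φ 0}` embeds
smoothly in `ℝ⁴`. TRUE (M–L): the defect `D` is closed in `S⁴`, so `f(D)` is compact and
`φ⁻¹(f D) ⊆ B(0,r)`; the radial push `x ↦ ρ(‖x‖) x/‖x‖` (`ρ = id` near `‖x‖ ≥ 2r`, `ρ > r`) transported by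
`φ` and extended by the identity is a diffeomorphism `M ∖ {φ 0} → M ∖ φ(B̄(0,r)) ⊆ M ∖ f(D)`; on
`S⁴ ∖ D` the map `f` is an injective local diffeomorphism, so `f⁻¹` is a smooth open embedding of
`M ∖ f(D)` into `S⁴` (`Literature.Topology.FourManifolds.isSmoothEmbedding_of_isLocalDiffeomorph`,
`Literature.Geometry.Manifold.isSmoothEmbedding_comp_of_inverse`); its restriction misses `f⁻¹ (φ 0)`, and
the stereographic chart from that point is a diffeomorphism onto `ℝ⁴`
(`Literature.Topology.FourManifolds.chartDiffeomorph`). [folklore] -/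
theorem stub_pushOffFrom :
    ∀ (M : Type) [TopologicalSpace M] [T2Space M] [SecondCountableTopology M]
      [ChartedSpace ℝ⁴ M] [IsManifold (𝓡 4) ∞ M] [CompactSpace M]
      (f : 𝕊⁴ → M) (φ : ℝ⁴ → M), ContMDiff (𝓡 4) (𝓡 4) ∞ f → Function.Bijective f →
        ContMDiff (𝓡 4) (𝓡 4) ∞ φ → Function.Injective φ → IsLocalDiffeomorph (𝓡 4) (𝓡 4) ∞ φ →
        (∀ x : 𝕊⁴, ¬ IsLocalDiffeomorphAt (𝓡 4) (𝓡 4) ∞ f x → f x ∈ Set.range φ) →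
          ∃ e : (⟨{φ 0}ᶜ, isOpen_compl_singleton⟩ : TopologicalSpace.Opens M) → ℝ⁴,
            Manifold.IsSmoothEmbedding (𝓡 4) (𝓡 4) ∞ e := by
  sorry

/-- **Stub P_T `stub_pushOffTo` — engulfed defect ⟹ punctured embedding (target side).** Let
`g : M → S⁴` be a smooth bijection from a closed smooth 4-manifold and `φ : ℝ⁴ → M` an injective local
diffeomorphism whose range contains every non-regular point of `g`. Then `M ∖ {φ 0}` embeds smoothly in
`ℝ⁴`. TRUE (M–L): the defect `D` is closed hence compact, `φ⁻¹(D) ⊆ B(0,r)`; radial push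
`M ∖ {φ 0} ≅ M ∖ φ(B̄(0,r)) ⊆ M ∖ D`; `g` restricted to the open set of regular points is an injective
local diffeomorphism, hence a smooth open embedding into `S⁴`
(`Literature.Topology.FourManifolds.isOpen_setOf_isLocalDiffeomorphAt`,
`…isSmoothEmbedding_of_isLocalDiffeomorph`); it misses `g (φ 0)`; compose with the stereographic chart
from `g (φ 0)` (`Literature.Topology.FourManifolds.chartDiffeomorph`). [folklore] -/
theorem stub_pushOffTo :
    ∀ (M : Type) [TopologicalSpace M] [T2Space M] [SecondCountableTopology M]
      [ChartedSpace ℝ⁴ M] [IsManifold (𝓡 4) ∞ M] [CompactSpace M]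
      (g : M → 𝕊⁴) (φ : ℝ⁴ → M), ContMDiff (𝓡 4) (𝓡 4) ∞ g → Function.Bijective g →
        ContMDiff (𝓡 4) (𝓡 4) ∞ φ → Function.Injective φ → IsLocalDiffeomorph (𝓡 4) (𝓡 4) ∞ φ →
        (∀ y : M, ¬ IsLocalDiffeomorphAt (𝓡 4) (𝓡 4) ∞ g y → y ∈ Set.range φ) →
          ∃ e : (⟨{φ 0}ᶜ, isOpen_compl_singleton⟩ : TopologicalSpace.Opens M) → ℝ⁴,
            Manifold.IsSmoothEmbedding (𝓡 4) (𝓡 4) ∞ e := by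
  sorry

/-- **Stub H `stub_homogeneity` — VERBATIM the birth line's stub H** (punctured embeddability does not
depend on the puncture on a connected smooth 4-manifold: Milnor's homogeneity lemma + transport of a smooth
embedding along the restricted diffeomorphism; tree `Literature.Topology.FourManifolds.Homogeneity`).
One proof closes this stub for both lines. TRUE; size M–L. [cite: MilnorTDV1965, §4 Homogeneity Lemma] -/
theorem stub_homogeneity :
    ∀ (M : Type) [TopologicalSpace M] [T2Space M] [SecondCountableTopology M]
      [ChartedSpace ℝ⁴ M] [IsManifold (𝓡 4) ∞ M] [ConnectedSpace M] (p q : M),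
      (∃ e : (⟨{q}ᶜ, isOpen_compl_singleton⟩ : TopologicalSpace.Opens M) → ℝ⁴,
          Manifold.IsSmoothEmbedding (𝓡 4) (𝓡 4) ∞ e) →
        ∃ e : (⟨{p}ᶜ, isOpen_compl_singleton⟩ : TopologicalSpace.Opens M) → ℝ⁴,
          Manifold.IsSmoothEmbedding (𝓡 4) (𝓡 4) ∞ e := by
  sorry

/-! ## Sorry-free glue -/

/-- A space homotopy equivalent to a path-connected space is path connected. [folklore] -/
theorem pathConnectedSpace_of_homotopyEquiv' {X Y : Type*} [TopologicalSpace X]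
    [TopologicalSpace Y] [PathConnectedSpace X] (e : ContinuousMap.HomotopyEquiv X Y) :
    PathConnectedSpace Y := by
  have key : ∀ y : Y, Joined (e.toFun (e.invFun y)) y := fun y =>
    ⟨e.right_inv.some.evalAt y⟩
  refine ⟨⟨e.toFun (Classical.arbitrary X)⟩, fun y y' => ?_⟩
  have hmid : Joined (e.toFun (e.invFun y)) (e.toFun (e.invFun y')) :=
    ⟨(PathConnectedSpace.somePath (e.invFun y) (e.invFun y')).map e.toFun.continuous⟩
  exact ((key y).symm.trans hmid).trans (key y')

/-- The round 4-sphere is path connected. [folklore] -/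
theorem pathConnectedSpace_sphereFour : PathConnectedSpace 𝕊⁴ := by
  rw [← isPathConnected_iff_pathConnectedSpace]
  refine isPathConnected_sphere ?_ 0 zero_le_one
  rw [← Module.finrank_eq_rank, finrank_euclideanSpace_fin]
  norm_num

/-- The carrier of a homotopy 4-sphere is connected. [folklore] -/
theorem connectedSpace_carrier (S : HomotopySphere 4) : ConnectedSpace S.carrier := by
  haveI : PathConnectedSpace 𝕊⁴ := pathConnectedSpace_sphereFour
  haveI : PathConnectedSpace S.carrier :=
    pathConnectedSpace_of_homotopyEquiv' S.nonempty_homotopyEquiv.some.symm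
  infer_instance

/-- **Composition with explicit hypotheses** (`H → P_F → P_T → E_F → E_T → body of ShRigid`). Pure logic:
case on the direction of comparison; E engulfs the Σ-side defect by a chart `φ`; P embeds `Σ ∖ {φ 0}`;
H moves the puncture to `p` (connectedness of `Σ`: `connectedSpace_carrier`). [folklore] -/
theorem shRigid_of_stubSigs
    (hH : ∀ (M : Type) [TopologicalSpace M] [T2Space M] [SecondCountableTopology M]
      [ChartedSpace ℝ⁴ M] [IsManifold (𝓡 4) ∞ M] [ConnectedSpace M] (p q : M),
      (∃ e : (⟨{q}ᶜ, isOpen_compl_singleton⟩ : TopologicalSpace.Opens M) → ℝ⁴,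
          Manifold.IsSmoothEmbedding (𝓡 4) (𝓡 4) ∞ e) →
        ∃ e : (⟨{p}ᶜ, isOpen_compl_singleton⟩ : TopologicalSpace.Opens M) → ℝ⁴,
          Manifold.IsSmoothEmbedding (𝓡 4) (𝓡 4) ∞ e)
    (hPF : ∀ (M : Type) [TopologicalSpace M] [T2Space M] [SecondCountableTopology M]
      [ChartedSpace ℝ⁴ M] [IsManifold (𝓡 4) ∞ M] [CompactSpace M]
      (f : 𝕊⁴ → M) (φ : ℝ⁴ → M), ContMDiff (𝓡 4) (𝓡 4) ∞ f → Function.Bijective f →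
        ContMDiff (𝓡 4) (𝓡 4) ∞ φ → Function.Injective φ → IsLocalDiffeomorph (𝓡 4) (𝓡 4) ∞ φ →
        (∀ x : 𝕊⁴, ¬ IsLocalDiffeomorphAt (𝓡 4) (𝓡 4) ∞ f x → f x ∈ Set.range φ) →
          ∃ e : (⟨{φ 0}ᶜ, isOpen_compl_singleton⟩ : TopologicalSpace.Opens M) → ℝ⁴,
            Manifold.IsSmoothEmbedding (𝓡 4) (𝓡 4) ∞ e)
    (hPT : ∀ (M : Type) [TopologicalSpace M] [T2Space M] [SecondCountableTopology M]
      [ChartedSpace ℝ⁴ M] [IsManifold (𝓡 4) ∞ M] [CompactSpace M]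
      (g : M → 𝕊⁴) (φ : ℝ⁴ → M), ContMDiff (𝓡 4) (𝓡 4) ∞ g → Function.Bijective g →
        ContMDiff (𝓡 4) (𝓡 4) ∞ φ → Function.Injective φ → IsLocalDiffeomorph (𝓡 4) (𝓡 4) ∞ φ →
        (∀ y : M, ¬ IsLocalDiffeomorphAt (𝓡 4) (𝓡 4) ∞ g y → y ∈ Set.range φ) →
          ∃ e : (⟨{φ 0}ᶜ, isOpen_compl_singleton⟩ : TopologicalSpace.Opens M) → ℝ⁴,
            Manifold.IsSmoothEmbedding (𝓡 4) (𝓡 4) ∞ e)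
    (hEF : ∀ (M : Type) [TopologicalSpace M] [T2Space M] [SecondCountableTopology M]
      [ChartedSpace ℝ⁴ M] [IsManifold (𝓡 4) ∞ M] [CompactSpace M]
      (f : 𝕊⁴ → M), ContMDiff (𝓡 4) (𝓡 4) ∞ f → Function.Bijective f →
        ∃ φ : ℝ⁴ → M, ContMDiff (𝓡 4) (𝓡 4) ∞ φ ∧ Function.Injective φ ∧
          IsLocalDiffeomorph (𝓡 4) (𝓡 4) ∞ φ ∧
          ∀ x : 𝕊⁴, ¬ IsLocalDiffeomorphAt (𝓡 4) (𝓡 4) ∞ f x → f x ∈ Set.range φ)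
    (hET : ∀ (M : Type) [TopologicalSpace M] [T2Space M] [SecondCountableTopology M]
      [ChartedSpace ℝ⁴ M] [IsManifold (𝓡 4) ∞ M] [CompactSpace M]
      (g : M → 𝕊⁴), ContMDiff (𝓡 4) (𝓡 4) ∞ g → Function.Bijective g →
        ∃ φ : ℝ⁴ → M, ContMDiff (𝓡 4) (𝓡 4) ∞ φ ∧ Function.Injective φ ∧
          IsLocalDiffeomorph (𝓡 4) (𝓡 4) ∞ φ ∧
          ∀ y : M, ¬ IsLocalDiffeomorphAt (𝓡 4) (𝓡 4) ∞ g y → y ∈ Set.range φ) :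
    ∀ S : HomotopySphere 4,
      ((∃ f : 𝕊⁴ → S.carrier, ContMDiff (𝓡 4) (𝓡 4) ∞ f ∧ Function.Bijective f) ∨
        (∃ g : S.carrier → 𝕊⁴, ContMDiff (𝓡 4) (𝓡 4) ∞ g ∧ Function.Bijective g)) →
      ∀ p : S.carrier, ∃ e : (⟨{p}ᶜ, isOpen_compl_singleton⟩ : TopologicalSpace.Opens S.carrier) → ℝ⁴,
        Manifold.IsSmoothEmbedding (𝓡 4) (𝓡 4) ∞ e := by
  intro S hS p
  haveI : ConnectedSpace S.carrier := connectedSpace_carrier S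
  rcases hS with ⟨f, hf, hbij⟩ | ⟨g, hg, hbij⟩
  · obtain ⟨φ, hφs, hφi, hφl, hD⟩ := hEF S.carrier f hf hbij
    exact hH S.carrier p (φ 0) (hPF S.carrier f φ hf hbij hφs hφi hφl hD)
  · obtain ⟨φ, hφs, hφi, hφl, hD⟩ := hET S.carrier g hg hbij
    exact hH S.carrier p (φ 0) (hPT S.carrier g φ hg hbij hφs hφi hφl hD)

/-! ## The skeleton theorem -/

/-- **THE SKELETON THEOREM (line `engulf`).** The crux
`Summit.SmoothPoincare4.SmoothPoincare4.Theses.SmoothBijectionDefect.ShRigid`, concluded BY NAME from the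
five declared stubs through the sorry-free composition `shRigid_of_stubSigs`; the only `sorry`s of the
file are the five `stub_*` bodies. [folklore] -/
theorem ShRigid_of : ShRigid :=
  shRigid_of_stubSigs stub_homogeneity stub_pushOffFrom stub_pushOffTo stub_engulfFrom stub_engulfTo

end Summit.SmoothPoincare4.SmoothPoincare4.Cruxes.ShRigid.Engulf

end
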